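import Literature.NumberTheory.Sieve.IwaniecAlmostPrimes
import Literature.NumberTheory.Sieve.ChenSwitchingConstant
import HarnessLib

/-!
# Iwaniec (1978), §6 p. 187: the numerical evaluation — PROVED; parity.S19 from Proposition 2

Third file on H. Iwaniec, *Almost-primes represented by quadratic polynomials*, Invent. Math.
**47** (1978) 171–188 [cite: IwaniecInventiones1978, §6 p. 187].  The first file
(`IwaniecAlmostPrimes.lean`) reduces parity.S19 to display (2); the second
(`IwaniecAlmostPrimesWeightedSum.lean`) proves (2) from Proposition 2 up to the numerical inequality
`e^γ/770 < f(16/3) − T3 − T4 − T5` for the linear-sieve functions.  Here that inequality is PROVED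
for every solution of the delay-differential system, so that

* `IsLinearSieveFunctions.numerics : IsLinearSieveFunctions F f →
    e^γ/770 < f(16/3) − T3 − T4 − T5`,

which together with `weightedSum_lower_of_prop2_of_numerics'` of the second file gives
`proposition2_upper → proposition2_lower → weightedSum_lower → parity.S19` (the two-line glue is
kept in `IwaniecAlmostPrimesConclusion.lean` so that this file depends on the first file and
`ChenSwitchingConstant.lean` only).
Everything in Iwaniec's paper from Proposition 2 (p. 185) to the Theorem is thereby formal; what
remains named are Proposition 2 itself (⇐ Lemma 2 = Iwaniec's bilinear-remainder linear sieve, Acta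
Arith. 1980, and the Corollary of Proposition 1 ⇐ Lemma 4 (corrected) ⇐ Hooley's Kloosterman-sum
bound, i.e. Weil's estimate).

**The computation** (p. 187: "we succeed partly in reducing the problem to the estimation of few
logarithms of rational numbers").  With `A = 2e^γ`, `I(w) = ∫_2^w log(u−1) du/u`,
`K = ∫_3^{13/3} I(s−1) ds/s`, `J₂ = ∫_3^{13/3} (s − 17/15) I(s−1) ds/(s(s+1))`:
`f(16/3) = (3A/16)(log(13/3) + K)` (second display of p. 187); `T4` splits at `u = 7/15` into an
elementary integral and `(A/5)(log(13/9) + K)` (linear substitution `s = 5(16/15 − u)`, first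
display of p. 187); `T3` splits at `u = 4/15` into an elementary integral and `(3/16) J`,
`J = A(J₁ + J₂)` (substitution `s = (16/15 − u)/u`); `T5` is elementary (`F = A/s`).  The
coefficients of `K` and `J₂` collect EXACTLY to `−(A/5) M`, `M = ∫_3^{13/3} I(s−1)(s−1) ds/(s(s+1))`
(`key_combination`), so `f(16/3) − T3 − T4 − T5 = A(C_log − M/5)` with `C_log` a combination of
logarithms of rationals; `M` is bounded through `I(w) ≤ Q(w − 2)` (`Q` a quintic, from
`log(1 + y) ≤ y − y²/2 + y³/3`, the tree's `Literature.NumberTheory.Sieve.Chen.log_one_add_le_cubic`, and the chord of `1/u`),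
whose integral against the rational weight is again logarithms (`Pm`).  Finally
`1/1540 < C_log − (Pm(13/3) − Pm(3))/5 = 0.0012087…` from
Mathlib's nine-place bounds on `log 3, log 5` and eight-place bounds on `log 2, log 13`
(`Real.log_two_near_10`; `log 13 = 4 log 2 + log(1 − 3/16)` by the Taylor series with remainder
`Real.abs_log_sub_add_sum_range_le`); numerically the left side of the target is
`(f(16/3) − T3 − T4 − T5)/A = 0.0016843 > 1/1540 = 0.00064935`.
-/

open Filter Finset Real MeasureTheory intervalIntegral
open scoped Topology

noncomputable section

namespace Literature.NumberTheory.Sieve.Iwaniec1978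

/-- `log 2` to nine places (Mathlib's `Real.log_two_near_10`). [folklore] -/
theorem log_two_bounds : 0.6931471804 < Real.log 2 ∧ Real.log 2 < 0.6931471807 := by
  have h := Real.log_two_near_10
  rw [abs_le] at h
  constructor <;> linarith [h.1, h.2]

/-- `log 13` to eight places (`log 13 = 4 log 2 + log(1 − 3/16)`). [folklore] -/
theorem log_thirteen_bounds : 2.5649493563 < Real.log 13 ∧ Real.log 13 < 2.5649493586 := by
  have h := Real.abs_log_sub_add_sum_range_le (show |(3 / 16 : ℝ)| < 1 by norm_num) 12
  rw [abs_le] at h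
  norm_num [Finset.sum_range_succ] at h
  have e : Real.log (13 / 16) = Real.log 13 - 4 * Real.log 2 := by
    rw [Real.log_div (by norm_num) (by norm_num), show (16 : ℝ) = 2 ^ 4 by norm_num, Real.log_pow]
    norm_num
  rw [e] at h
  have h2 := log_two_bounds
  constructor <;> linarith [h.1, h.2, h2.1, h2.2]

/-! ### Elementary inequalities -/

/-- Chord bound for the convex function `1/u` on `[2, 10/3]`: `1/u ≤ 1/2 − (3/20)(u − 2)`.
[folklore] -/
theorem inv_le_chord {u : ℝ} (h2 : 2 ≤ u) (h3 : u ≤ 10 / 3) : u⁻¹ ≤ 1 / 2 - 3 / 20 * (u - 2) := by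
  rw [inv_le_iff_one_le_mul₀ (by linarith)]
  nlinarith

/-- The polynomial upper bound `Q(y) = y²/4 − 2y³/15 + 29y⁴/480 − y⁵/100` for `I(y + 2)`,
`0 ≤ y ≤ 4/3` (`= ∫_0^y (t − t²/2 + t³/3)(1/2 − 3t/20) dt`). [folklore] -/
def Qpoly (y : ℝ) : ℝ := y ^ 2 / 4 - 2 * y ^ 3 / 15 + 29 * y ^ 4 / 480 - y ^ 5 / 100

/-- `Q'(y) = (y − y²/2 + y³/3)(1/2 − 3y/20)`. [folklore] -/
theorem hasDerivAt_Qpoly (y : ℝ) :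
    HasDerivAt Qpoly ((y - y ^ 2 / 2 + y ^ 3 / 3) * (1 / 2 - 3 / 20 * y)) y := by
  unfold Qpoly
  have := ((((hasDerivAt_pow 2 y).div_const 4).sub
    (((hasDerivAt_pow 3 y).const_mul 2).div_const 15)).add
    (((hasDerivAt_pow 4 y).const_mul 29).div_const 480)).sub ((hasDerivAt_pow 5 y).div_const 100)
  refine this.congr_deriv ?_
  ring


/-! ### `I(w) ≤ Q(w − 2)` on `[2, 10/3]` -/

/-- **`I(w) ≤ Q(w − 2)` for `2 ≤ w ≤ 10/3`** (the only transcendental input of the numerics is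
bounded by a polynomial: `log(u − 1) ≤` cubic Taylor bound, `1/u ≤` chord). [folklore] -/
theorem logInt_le_Qpoly {w : ℝ} (h2 : 2 ≤ w) (h3 : w ≤ 10 / 3) : logInt w ≤ Qpoly (w - 2) := by
  unfold logInt
  have hcont : ContinuousOn (fun u : ℝ => Real.log (u - 1) / u) (Set.Icc 2 w) :=
    continuousOn_logInt_integrand.mono fun u hu => by
      simp only [Set.mem_Ioi]; linarith [hu.1]
  have hpoly : ∀ u : ℝ, HasDerivAt (fun u : ℝ => Qpoly (u - 2))
      ((u - 2 - (u - 2) ^ 2 / 2 + (u - 2) ^ 3 / 3) * (1 / 2 - 3 / 20 * (u - 2))) u := fun u => by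
    have := (hasDerivAt_Qpoly (u - 2)).comp u ((hasDerivAt_id u).sub_const 2)
    refine this.congr_deriv ?_
    rw [mul_one]
  have hval : ∫ u in (2 : ℝ)..w,
      (u - 2 - (u - 2) ^ 2 / 2 + (u - 2) ^ 3 / 3) * (1 / 2 - 3 / 20 * (u - 2)) = Qpoly (w - 2) := by
    rw [intervalIntegral.integral_eq_sub_of_hasDerivAt (fun u _ => hpoly u)]
    · simp [Qpoly]
    · exact (Continuous.intervalIntegrable (by fun_prop) _ _)
  rw [← hval]
  refine intervalIntegral.integral_mono_on h2 (hcont.intervalIntegrable_of_Icc h2)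
    (Continuous.intervalIntegrable (by fun_prop) _ _) fun u hu => ?_
  have hu1 : 2 ≤ u := hu.1
  have hu2 : u ≤ w := hu.2
  have hy : 0 ≤ u - 2 := by linarith
  have hlog : Real.log (u - 1) ≤ u - 2 - (u - 2) ^ 2 / 2 + (u - 2) ^ 3 / 3 := by
    have := Literature.NumberTheory.Sieve.Chen.log_one_add_le_cubic hy
    rwa [show 1 + (u - 2) = u - 1 by ring] at this
  have hlog0 : 0 ≤ Real.log (u - 1) := Real.log_nonneg (by linarith)
  have hinv : u⁻¹ ≤ 1 / 2 - 3 / 20 * (u - 2) := inv_le_chord hu1 (by linarith)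
  rw [div_eq_mul_inv]
  exact mul_le_mul hlog hinv (inv_nonneg.mpr (by linarith)) (hlog0.trans hlog)

/-! ### The integrals `K`, `J`, `J₂`, `M`, the polynomial primitive `Pm` and the constant `Cnum` -/

/-- The `K`-integral `∫_3^{13/3} I(s − 1) ds/s` (common to `f(16/3)`, `T3`, `T4`). [folklore] -/
def Kint : ℝ := ∫ s in (3 : ℝ)..(13 / 3), logInt (s - 1) / s

/-- The `J`-integral `∫_3^{13/3} (s − 17/15) F(s)/(s + 1) ds` arising from the substitution
`s = (16/15 − u)/u` in `T3`. [folklore] -/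
def Jint (F : ℝ → ℝ) : ℝ := ∫ s in (3 : ℝ)..(13 / 3), (s - 17 / 15) * F s / (s + 1)

/-- `J₂ = ∫_3^{13/3} (s − 17/15) I(s − 1)/(s(s + 1)) ds`. [folklore] -/
def J2int : ℝ := ∫ s in (3 : ℝ)..(13 / 3), (s - 17 / 15) * logInt (s - 1) / (s * (s + 1))

/-! ### The `I`-integral `M` and its polynomial bound -/

/-- `M = ∫_3^{13/3} I(s − 1)(s − 1)/(s(s+1)) ds`, the only non-elementary quantity left after the
exact cancellations (`W₅'/A = C_log − M/5`). [folklore] -/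
def Mint : ℝ := ∫ s in (3 : ℝ)..(13 / 3), logInt (s - 1) * (s - 1) / (s * (s + 1))

/-- `s ↦ I(s − 1)` is continuous on `[3, 13/3]`. [folklore] -/
theorem continuousOn_logInt_shift :
    ContinuousOn (fun s : ℝ => logInt (s - 1)) (Set.Icc 3 (13 / 3)) := fun s hs =>
  (hasDerivAt_logInt_sub_one (by linarith [hs.1] : (2:ℝ) < s)).continuousAt.continuousWithinAt

/-- `(1/80) K + (3/16) J₂ = (1/5) M` (the coefficient of `I` collects to `(1/5)(s−1)/(s(s+1))`).
[folklore] -/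
theorem key_combination : (1 / 80) * Kint + (3 / 16) * J2int = (1 / 5) * Mint := by
  unfold Kint J2int Mint
  have hden : ∀ s ∈ Set.Icc (3 : ℝ) (13 / 3), s ≠ 0 ∧ s + 1 ≠ 0 ∧ s * (s + 1) ≠ 0 := fun s hs =>
    ⟨by linarith [hs.1], by linarith [hs.1], mul_ne_zero (by linarith [hs.1]) (by linarith [hs.1])⟩
  have hi1 : IntervalIntegrable (fun s : ℝ => logInt (s - 1) / s) MeasureTheory.volume
      (3 : ℝ) (13 / 3) :=
    (continuousOn_logInt_shift.div continuousOn_id fun s hs => (hden s hs).1)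
      |>.intervalIntegrable_of_Icc (by norm_num)
  have hi2 : IntervalIntegrable (fun s : ℝ => (s - 17 / 15) * logInt (s - 1) / (s * (s + 1)))
      MeasureTheory.volume (3 : ℝ) (13 / 3) :=
    (((continuousOn_id.sub continuousOn_const).mul continuousOn_logInt_shift).div
      (continuousOn_id.mul (continuousOn_id.add continuousOn_const)) fun s hs => (hden s hs).2.2)
      |>.intervalIntegrable_of_Icc (by norm_num)
  rw [← intervalIntegral.integral_const_mul, ← intervalIntegral.integral_const_mul,
    ← intervalIntegral.integral_const_mul,
    ← intervalIntegral.integral_add (hi1.const_mul _) (hi2.const_mul _)]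
  refine intervalIntegral.integral_congr fun s hs => ?_
  rw [Set.uIcc_of_le (by norm_num : (3:ℝ) ≤ 13/3)] at hs
  obtain ⟨h1, h2, h3⟩ := hden s hs
  field_simp
  ring

/-- The primitive of `Q(s − 3)(s − 1)/(s(s + 1))`: polynomial part
`− q(0) log s + 2 q(−1) log(s + 1)` with `q(s) = Q(s − 3)`, `q(0) = 10539/800`,
`q(−1) = 956/25`. [folklore] -/
def Pm (s : ℝ) : ℝ :=
  (-13783 / 400) * s + (1137 / 200) * s ^ 2 - (2639 / 3600) * s ^ 3 + (553 / 9600) * s ^ 4 -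
    (1 / 500) * s ^ 5 - (10539 / 800) * Real.log s + 2 * (956 / 25) * Real.log (s + 1)

/-- `Pm' = Q(s − 3)(s − 1)/(s(s + 1))` on `s > 0`. [folklore] -/
theorem hasDerivAt_Pm {s : ℝ} (hs : 0 < s) :
    HasDerivAt Pm (Qpoly (s - 3) * (s - 1) / (s * (s + 1))) s := by
  unfold Pm Qpoly
  have hs0 : s ≠ 0 := hs.ne'
  have hs1 : s + 1 ≠ 0 := by linarith
  have h := ((((((hasDerivAt_id' s).const_mul (-13783 / 400 : ℝ)).add
    ((hasDerivAt_pow 2 s).const_mul (1137 / 200 : ℝ))).sub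
    ((hasDerivAt_pow 3 s).const_mul (2639 / 3600 : ℝ))).add
    ((hasDerivAt_pow 4 s).const_mul (553 / 9600 : ℝ))).sub
    ((hasDerivAt_pow 5 s).const_mul (1 / 500 : ℝ))).sub
    ((Real.hasDerivAt_log hs0).const_mul (10539 / 800 : ℝ)) |>.add
    ((((hasDerivAt_id' s).add_const (1 : ℝ)).log hs1).const_mul (2 * (956 / 25) : ℝ))
  refine h.congr_deriv ?_
  field_simp
  ring

/-- `M ≤ Pm(13/3) − Pm(3) = 0.0201085…` (from `I ≤ Q`; the true value is `0.01773`). [folklore] -/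
theorem Mint_le : Mint ≤ Pm (13 / 3) - Pm 3 := by
  unfold Mint
  have hval : ∫ s in (3 : ℝ)..(13 / 3), Qpoly (s - 3) * (s - 1) / (s * (s + 1)) =
      Pm (13 / 3) - Pm 3 := by
    refine intervalIntegral.integral_eq_sub_of_hasDerivAt (fun s hs => hasDerivAt_Pm ?_) ?_
    · rw [Set.uIcc_of_le (by norm_num : (3:ℝ) ≤ 13/3)] at hs; linarith [hs.1]
    · refine ContinuousOn.intervalIntegrable_of_Icc (by norm_num) ?_
      refine ContinuousOn.div (ContinuousOn.mul ?_ (continuousOn_id.sub continuousOn_const))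
        (continuousOn_id.mul (continuousOn_id.add continuousOn_const)) fun s hs => ?_
      · unfold Qpoly; fun_prop
      · exact mul_ne_zero (by linarith [hs.1]) (by linarith [hs.1])
  rw [← hval]
  refine intervalIntegral.integral_mono_on (by norm_num) ?_ ?_ fun s hs => ?_
  · refine ContinuousOn.intervalIntegrable_of_Icc (by norm_num) ?_
    exact (continuousOn_logInt_shift.mul (continuousOn_id.sub continuousOn_const)).div
      (continuousOn_id.mul (continuousOn_id.add continuousOn_const)) fun s hs =>
        mul_ne_zero (by linarith [hs.1]) (by linarith [hs.1])
  · refine ContinuousOn.intervalIntegrable_of_Icc (by norm_num) ?_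
    refine ContinuousOn.div (ContinuousOn.mul ?_ (continuousOn_id.sub continuousOn_const))
      (continuousOn_id.mul (continuousOn_id.add continuousOn_const)) fun s hs => ?_
    · unfold Qpoly; fun_prop
    · exact mul_ne_zero (by linarith [hs.1]) (by linarith [hs.1])
  · have hI : logInt (s - 1) ≤ Qpoly (s - 3) := by
      have := logInt_le_Qpoly (w := s - 1) (by linarith [hs.1]) (by linarith [hs.2])
      rwa [show s - 1 - 2 = s - 3 by ring] at this
    have hw : 0 ≤ (s - 1) / (s * (s + 1)) :=
      div_nonneg (by linarith [hs.1]) (mul_nonneg (by linarith [hs.1]) (by linarith [hs.1]))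
    calc logInt (s - 1) * (s - 1) / (s * (s + 1))
        = logInt (s - 1) * ((s - 1) / (s * (s + 1))) := by ring
      _ ≤ Qpoly (s - 3) * ((s - 1) / (s * (s + 1))) := mul_le_mul_of_nonneg_right hI hw
      _ = Qpoly (s - 3) * (s - 1) / (s * (s + 1)) := by ring

/-! ### The numerical constant -/

/-- The explicit lower bound `Cnum ≤ (f(16/3) − T3 − T4 − T5)/A` (`Cnum = 0.0012087…`; the true
value of the left side is `0.0016843`, Iwaniec's `W₅/A` with the double sum is `0.0028114`).
[folklore] -/
def Cnum : ℝ :=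
  (3 / 16) * Real.log (16 / 3 - 1)
  - (3 / 16) * ((-(17 / 15) * Real.log (13 / 3) + (32 / 15) * Real.log (13 / 3 + 1)) -
      (-(17 / 15) * Real.log 3 + (32 / 15) * Real.log (3 + 1)))
  - (1 / 5) * Real.log ((13 / 3) / 3)
  - (1 / 5 * ((15 / 16) * Real.log (1 / 2) + (17 / 16) * Real.log (16 / 15 - 1 / 2)) -
      1 / 5 * ((15 / 16) * Real.log (4 / 15) + (17 / 16) * Real.log (16 / 15 - 4 / 15)))
  - ((-(1 / 5) * Real.log (16 / 15 - 1 / 2)) - (-(1 / 5) * Real.log (16 / 15 - 7 / 15)))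
  - 1 / 5 * ((15 / 16) * (Real.log 1 - Real.log (1 / 2)) +
      (1 / 16) * (Real.log (16 / 15 - 1) - Real.log (16 / 15 - 1 / 2)))
  - (1 / 5) * (Pm (13 / 3) - Pm 3)

/-- The pure numerical fact: `1/1540 < Cnum` (`1/1540 = 0.000649…`, `Cnum = 0.0012087…`), from the
bounds on `log 2, log 3, log 5, log 13` (the `log 17` terms cancel). [folklore] -/
theorem Cnum_gt : 1 / 1540 < Cnum := by
  unfold Cnum Pm
  have h2 := log_two_bounds
  have h3 : (1.0986122885 : ℝ) < Real.log 3 ∧ Real.log 3 < 1.0986122888 :=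
    ⟨Real.log_three_gt_d9, Real.log_three_lt_d9⟩
  have h5 : (1.6094379123 : ℝ) < Real.log 5 ∧ Real.log 5 < 1.6094379126 :=
    ⟨Real.log_five_gt_d9, Real.log_five_lt_d9⟩
  have h13 := log_thirteen_bounds
  have e1 : Real.log (13 / 3) = Real.log 13 - Real.log 3 := by
    rw [Real.log_div (by norm_num) (by norm_num)]
  have e2 : Real.log (16 / 3) = 4 * Real.log 2 - Real.log 3 := by
    rw [Real.log_div (by norm_num) (by norm_num), show (16:ℝ) = 2 ^ 4 by norm_num, Real.log_pow]
    norm_num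
  have e3 : Real.log 4 = 2 * Real.log 2 := by
    rw [show (4:ℝ) = 2 ^ 2 by norm_num, Real.log_pow]; norm_num
  have e4 : Real.log (13 / 9) = Real.log 13 - 2 * Real.log 3 := by
    rw [Real.log_div (by norm_num) (by norm_num), show (9:ℝ) = 3 ^ 2 by norm_num, Real.log_pow]
    norm_num
  have e5 : Real.log (17 / 30) = Real.log 17 - Real.log 2 - Real.log 3 - Real.log 5 := by
    rw [Real.log_div (by norm_num) (by norm_num), show (30:ℝ) = 2 * 3 * 5 by norm_num,
      Real.log_mul (by norm_num) (by norm_num), Real.log_mul (by norm_num) (by norm_num)]; ring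
  have e6 : Real.log (4 / 5) = 2 * Real.log 2 - Real.log 5 := by
    rw [Real.log_div (by norm_num) (by norm_num), e3]
  have e7 : Real.log (3 / 5) = Real.log 3 - Real.log 5 := by
    rw [Real.log_div (by norm_num) (by norm_num)]
  have e8 : Real.log (1 / 15) = -Real.log 3 - Real.log 5 := by
    rw [Real.log_div (by norm_num) (by norm_num), Real.log_one, show (15:ℝ) = 3 * 5 by norm_num,
      Real.log_mul (by norm_num) (by norm_num)]; ring
  have e9 : Real.log (1 / 2) = -Real.log 2 := by
    rw [Real.log_div (by norm_num) (by norm_num), Real.log_one]; ring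
  have e10 : Real.log (4 / 15) = 2 * Real.log 2 - Real.log 3 - Real.log 5 := by
    rw [Real.log_div (by norm_num) (by norm_num), e3, show (15:ℝ) = 3 * 5 by norm_num,
      Real.log_mul (by norm_num) (by norm_num)]; ring
  have e11 : Real.log (13 / 3 + 1) = Real.log (16 / 3) := by norm_num
  have e12 : Real.log (3 + 1) = Real.log 4 := by norm_num
  have e13 : Real.log (16 / 3 - 1) = Real.log (13 / 3) := by norm_num
  have e14 : Real.log ((13 / 3) / 3) = Real.log (13 / 9) := by norm_num
  have e15 : Real.log (16 / 15 - 1 / 2) = Real.log (17 / 30) := by norm_num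
  have e16 : Real.log (16 / 15 - 4 / 15) = Real.log (4 / 5) := by norm_num
  have e17 : Real.log (16 / 15 - 7 / 15) = Real.log (3 / 5) := by norm_num
  have e18 : Real.log (16 / 15 - 1) = Real.log (1 / 15) := by norm_num
  have e19 : Real.log ((13:ℝ) / 3) = Real.log 13 - Real.log 3 := e1
  rw [e11, e12, e13, e14, e15, e16, e17, e18, Real.log_one]
  rw [e1, e2, e3, e4, e5, e6, e7, e8, e9, e10]
  norm_num
  linarith [h2.1, h2.2, h3.1, h3.2, h5.1, h5.2, h13.1, h13.2]

/-! ### Exact evaluation of `T5`, `T4`, `T3`, `T1` in terms of `K`, `J₂` and logarithms -/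

namespace IsLinearSieveFunctions
variable {F f : ℝ → ℝ}

/-- `T5 = G₅(1) − G₅(1/2)` with `G₅(u) = (A/5)((15/16) log u + (1/16) log(16/15 − u))` (here
`F = A/s`, `s ≤ 17/6`). [cite: IwaniecInventiones1978, §6 p. 187] -/
theorem T5_eq (h : IsLinearSieveFunctions F f) :
    ∫ u in (1 / 2 : ℝ)..1, (1 - u) * F (5 * (16 / 15 - u)) / u =
      sieveA / 5 * ((15 / 16) * (Real.log 1 - Real.log (1 / 2)) +
        (1 / 16) * (Real.log (16 / 15 - 1) - Real.log (16 / 15 - 1 / 2))) := by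
  have hcongr : ∀ u ∈ Set.uIcc (1 / 2 : ℝ) 1, (1 - u) * F (5 * (16 / 15 - u)) / u =
      sieveA / 5 * ((15 / 16) / u - (1 / 16) / (16 / 15 - u)) := by
    intro u hu
    rw [Set.uIcc_of_le (by norm_num : (1/2:ℝ) ≤ 1)] at hu
    have hu0 : u ≠ 0 := by linarith [hu.1]
    have hu1 : (16 / 15 - u) ≠ 0 := by linarith [hu.2]
    have hu1' : (16 - u * 15 : ℝ) ≠ 0 := ne_of_gt (by linarith [hu.2])
    rw [h.upper_eq_div (by linarith [hu.2]) (by linarith [hu.1])]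
    field_simp
    ring
  rw [intervalIntegral.integral_congr hcongr]
  have hderiv : ∀ u ∈ Set.uIcc (1 / 2 : ℝ) 1,
      HasDerivAt
        (fun u : ℝ => sieveA / 5 * ((15 / 16) * Real.log u + (1 / 16) * Real.log (16 / 15 - u)))
        (sieveA / 5 * ((15 / 16) / u - (1 / 16) / (16 / 15 - u))) u := by
    intro u hu
    rw [Set.uIcc_of_le (by norm_num : (1/2:ℝ) ≤ 1)] at hu
    have hu0 : u ≠ 0 := by linarith [hu.1]
    have hu1 : (16 / 15 - u) ≠ 0 := by linarith [hu.2]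
    have hu1' : (16 - u * 15 : ℝ) ≠ 0 := ne_of_gt (by linarith [hu.2])
    have h1 := (Real.hasDerivAt_log hu0).const_mul (15 / 16 : ℝ)
    have h2 := (((hasDerivAt_id u).const_sub (16 / 15 : ℝ)).log hu1).const_mul (1 / 16 : ℝ)
    have h3 := (h1.add h2).const_mul (sieveA / 5)
    refine h3.congr_deriv ?_
    (try simp only [id])
    field_simp
    ring
  have hint : IntervalIntegrable
      (fun u : ℝ => sieveA / 5 * ((15 / 16) / u - (1 / 16) / (16 / 15 - u)))
      MeasureTheory.volume (1 / 2 : ℝ) 1 := by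
    refine (ContinuousOn.intervalIntegrable_of_Icc (by norm_num) ?_)
    refine continuousOn_const.mul ((continuousOn_const.div continuousOn_id fun u hu => ?_).sub
      (continuousOn_const.div (continuousOn_const.sub continuousOn_id) fun u hu => ?_))
    · (try simp only [id]); linarith [hu.1]
    · linarith [hu.2]
  rw [intervalIntegral.integral_eq_sub_of_hasDerivAt hderiv hint]
  ring

/-- The elementary part of `T4`: `∫_{7/15}^{1/2} F(5(16/15 − u)) du = (A/5)(log(3/5) − log(17/30))`
in the form `G₄(1/2) − G₄(7/15)`, `G₄(u) = −(A/5) log(16/15 − u)`.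
[cite: IwaniecInventiones1978, §6 p. 187] -/
theorem T4b_eq (h : IsLinearSieveFunctions F f) :
    ∫ u in (7 / 15 : ℝ)..(1 / 2), F (5 * (16 / 15 - u)) =
      (-(sieveA / 5) * Real.log (16 / 15 - 1 / 2)) -
        (-(sieveA / 5) * Real.log (16 / 15 - 7 / 15)) := by
  have hcongr : ∀ u ∈ Set.uIcc (7 / 15 : ℝ) (1 / 2), F (5 * (16 / 15 - u)) =
      sieveA / 5 / (16 / 15 - u) := by
    intro u hu
    rw [Set.uIcc_of_le (by norm_num : (7/15:ℝ) ≤ 1/2)] at hu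
    have hu1 : (16 / 15 - u) ≠ 0 := by linarith [hu.2]
    have hu1' : (16 - u * 15 : ℝ) ≠ 0 := ne_of_gt (by linarith [hu.2])
    rw [h.upper_eq_div (by linarith [hu.2]) (by linarith [hu.1])]
    field_simp
  rw [intervalIntegral.integral_congr hcongr]
  have hderiv : ∀ u ∈ Set.uIcc (7 / 15 : ℝ) (1 / 2),
      HasDerivAt (fun u : ℝ => -(sieveA / 5) * Real.log (16 / 15 - u))
        (sieveA / 5 / (16 / 15 - u)) u := by
    intro u hu
    rw [Set.uIcc_of_le (by norm_num : (7/15:ℝ) ≤ 1/2)] at hu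
    have hu1 : (16 / 15 - u) ≠ 0 := by linarith [hu.2]
    have hu1' : (16 - u * 15 : ℝ) ≠ 0 := ne_of_gt (by linarith [hu.2])
    have h2 := (((hasDerivAt_id u).const_sub (16 / 15 : ℝ)).log hu1).const_mul (-(sieveA / 5))
    refine h2.congr_deriv ?_
    (try simp only [id])
    field_simp
  have hint : IntervalIntegrable (fun u : ℝ => sieveA / 5 / (16 / 15 - u))
      MeasureTheory.volume (7 / 15 : ℝ) (1 / 2) := by
    refine (ContinuousOn.intervalIntegrable_of_Icc (by norm_num) ?_)
    exact continuousOn_const.div (continuousOn_const.sub continuousOn_id) fun u hu => by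
      linarith [hu.2]
  rw [intervalIntegral.integral_eq_sub_of_hasDerivAt hderiv hint]

/-- `∫_3^{13/3} F(s) ds = A (log((13/3)/3) + K)` (`F = A(1 + I(s − 1))/s` on `[3, 5]`).
[cite: IwaniecInventiones1978, §6 p. 187] -/
theorem integral_upper_three (h : IsLinearSieveFunctions F f) :
    ∫ s in (3 : ℝ)..(13 / 3), F s = sieveA * (Real.log ((13 / 3) / 3) + Kint) := by
  have hcongr : ∀ s ∈ Set.uIcc (3 : ℝ) (13 / 3), F s =
      sieveA * (1 / s) + sieveA * (logInt (s - 1) / s) := by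
    intro s hs
    rw [Set.uIcc_of_le (by norm_num : (3:ℝ) ≤ 13/3)] at hs
    rw [h.upper_eq_logInt_div hs.1 (by linarith [hs.2])]
    have : s ≠ 0 := by linarith [hs.1]
    field_simp
  rw [intervalIntegral.integral_congr hcongr]
  have hi1 : IntervalIntegrable (fun s : ℝ => sieveA * (1 / s)) MeasureTheory.volume
      (3 : ℝ) (13 / 3) := by
    refine (ContinuousOn.intervalIntegrable_of_Icc (by norm_num) ?_)
    exact continuousOn_const.mul (continuousOn_const.div continuousOn_id fun s hs => by
      linarith [hs.1])
  have hi2 : IntervalIntegrable (fun s : ℝ => sieveA * (logInt (s - 1) / s)) MeasureTheory.volume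
      (3 : ℝ) (13 / 3) := by
    refine (ContinuousOn.intervalIntegrable_of_Icc (by norm_num) ?_)
    exact continuousOn_const.mul (continuousOn_logInt_sub_one_div.mono fun s hs => by
      simp only [Set.mem_Ioi]; linarith [hs.1])
  rw [intervalIntegral.integral_add hi1 hi2, intervalIntegral.integral_const_mul,
    intervalIntegral.integral_const_mul, integral_one_div (by
      rw [Set.uIcc_of_le (by norm_num : (3:ℝ) ≤ 13/3)]
      intro h0; exact absurd h0.1 (by norm_num)), Kint]
  ring

/-- The transcendental part of `T4`: `∫_{1/5}^{7/15} F(5(16/15 − u)) du = (1/5) ∫_3^{13/3} F`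
(linear substitution). [folklore] -/
theorem T4a_eq (h : IsLinearSieveFunctions F f) :
    ∫ u in (1 / 5 : ℝ)..(7 / 15), F (5 * (16 / 15 - u)) =
      (1 / 5) * (sieveA * (Real.log ((13 / 3) / 3) + Kint)) := by
  have hcongr : ∀ u ∈ Set.uIcc (1 / 5 : ℝ) (7 / 15),
      F (5 * (16 / 15 - u)) = F (16 / 3 - 5 * u) := by
    intro u _; congr 1; ring
  rw [intervalIntegral.integral_congr hcongr,
    intervalIntegral.integral_comp_sub_mul (f := F) (by norm_num : (5:ℝ) ≠ 0) (16 / 3)]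
  norm_num
  rw [integral_upper_three h]
  ring

/-- `T4 = T4a + T4b`. [folklore] -/
theorem T4_eq (h : IsLinearSieveFunctions F f) :
    ∫ u in (1 / 5 : ℝ)..(1 / 2), F (5 * (16 / 15 - u)) =
      (1 / 5) * (sieveA * (Real.log ((13 / 3) / 3) + Kint)) +
      ((-(sieveA / 5) * Real.log (16 / 15 - 1 / 2)) -
        (-(sieveA / 5) * Real.log (16 / 15 - 7 / 15))) := by
  have hcont : ContinuousOn (fun u : ℝ => F (5 * (16 / 15 - u))) (Set.Icc (1 / 5) (1 / 2)) :=
    h.continuousOn_upper.comp (by fun_prop) fun u hu => by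
      simp only [Set.mem_Ioi]; linarith [hu.2]
  rw [← intervalIntegral.integral_add_adjacent_intervals (b := 7 / 15)
    (hcont.mono (Set.Icc_subset_Icc le_rfl (by norm_num)) |>.intervalIntegrable_of_Icc
      (by norm_num))
    (hcont.mono (Set.Icc_subset_Icc (by norm_num) le_rfl) |>.intervalIntegrable_of_Icc
      (by norm_num)),
    T4a_eq h, T4b_eq h]

/-- The elementary part of `T3`:
`∫_{4/15}^{1/2} (1 − 2u) F((16/15 − u)/u) ((1/5)/u)/u du = G₃(1/2) − G₃(4/15)`,
`G₃(u) = (A/5)((15/16) log u + (17/16) log(16/15 − u))`.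
[cite: IwaniecInventiones1978, §6 p. 187] -/
theorem T3b_eq (h : IsLinearSieveFunctions F f) :
    ∫ u in (4 / 15 : ℝ)..(1 / 2), (1 - 2 * u) * F ((16 / 15 - u) / u) * ((1 / 5) / u) / u =
      sieveA / 5 * ((15 / 16) * Real.log (1 / 2) + (17 / 16) * Real.log (16 / 15 - 1 / 2)) -
      sieveA / 5 * ((15 / 16) * Real.log (4 / 15) + (17 / 16) * Real.log (16 / 15 - 4 / 15)) := by
  have hcongr : ∀ u ∈ Set.uIcc (4 / 15 : ℝ) (1 / 2),
      (1 - 2 * u) * F ((16 / 15 - u) / u) * ((1 / 5) / u) / u =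
      sieveA / 5 * ((15 / 16) / u - (17 / 16) / (16 / 15 - u)) := by
    intro u hu
    rw [Set.uIcc_of_le (by norm_num : (4/15:ℝ) ≤ 1/2)] at hu
    have hu0 : u ≠ 0 := by linarith [hu.1]
    have hu1 : (16 / 15 - u) ≠ 0 := by linarith [hu.2]
    have hu1' : (16 - u * 15 : ℝ) ≠ 0 := ne_of_gt (by linarith [hu.2])
    have hs0 : 0 < (16 / 15 - u) / u := div_pos (by linarith [hu.2]) (by linarith [hu.1])
    have hs3 : (16 / 15 - u) / u ≤ 3 := by
      rw [div_le_iff₀ (by linarith [hu.1])]; linarith [hu.1]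
    rw [h.upper_eq_div hs0 hs3]
    field_simp
    ring
  rw [intervalIntegral.integral_congr hcongr]
  have hderiv : ∀ u ∈ Set.uIcc (4 / 15 : ℝ) (1 / 2),
      HasDerivAt
        (fun u : ℝ => sieveA / 5 * ((15 / 16) * Real.log u + (17 / 16) * Real.log (16 / 15 - u)))
        (sieveA / 5 * ((15 / 16) / u - (17 / 16) / (16 / 15 - u))) u := by
    intro u hu
    rw [Set.uIcc_of_le (by norm_num : (4/15:ℝ) ≤ 1/2)] at hu
    have hu0 : u ≠ 0 := by linarith [hu.1]
    have hu1 : (16 / 15 - u) ≠ 0 := by linarith [hu.2]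
    have hu1' : (16 - u * 15 : ℝ) ≠ 0 := ne_of_gt (by linarith [hu.2])
    have h1 := (Real.hasDerivAt_log hu0).const_mul (15 / 16 : ℝ)
    have h2 := (((hasDerivAt_id u).const_sub (16 / 15 : ℝ)).log hu1).const_mul (17 / 16 : ℝ)
    have h3 := (h1.add h2).const_mul (sieveA / 5)
    refine h3.congr_deriv ?_
    (try simp only [id])
    field_simp
    ring
  have hint : IntervalIntegrable
      (fun u : ℝ => sieveA / 5 * ((15 / 16) / u - (17 / 16) / (16 / 15 - u)))
      MeasureTheory.volume (4 / 15 : ℝ) (1 / 2) := by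
    refine (ContinuousOn.intervalIntegrable_of_Icc (by norm_num) ?_)
    refine continuousOn_const.mul ((continuousOn_const.div continuousOn_id fun u hu => ?_).sub
      (continuousOn_const.div (continuousOn_const.sub continuousOn_id) fun u hu => ?_))
    · (try simp only [id]); linarith [hu.1]
    · linarith [hu.2]
  rw [intervalIntegral.integral_eq_sub_of_hasDerivAt hderiv hint]

/-- The transcendental part of `T3` by the substitution `s = (16/15 − u)/u`:
`∫_{1/5}^{4/15} (1 − 2u) F((16/15 − u)/u) ((1/5)/u)/u du = (3/16) J`. [folklore] -/
theorem T3a_eq (h : IsLinearSieveFunctions F f) :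
    ∫ u in (1 / 5 : ℝ)..(4 / 15), (1 - 2 * u) * F ((16 / 15 - u) / u) * ((1 / 5) / u) / u =
      (3 / 16) * Jint F := by
  set φ : ℝ → ℝ := fun u => (16 / 15 - u) / u with hφ
  set φ' : ℝ → ℝ := fun u => -(16 / 15) / u ^ 2 with hφ'
  set Gc : ℝ → ℝ := fun s => -(3 / 16) * ((s - 17 / 15) / (s + 1)) * F s with hGc
  have huI : Set.uIcc (1 / 5 : ℝ) (4 / 15) = Set.Icc (1 / 5) (4 / 15) :=
    Set.uIcc_of_le (by norm_num)
  have hφd : ∀ u ∈ Set.uIcc (1 / 5 : ℝ) (4 / 15), HasDerivAt φ (φ' u) u := by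
    intro u hu
    rw [huI] at hu
    have hu0 : u ≠ 0 := by linarith [hu.1]
    have h1 := ((hasDerivAt_id u).const_sub (16 / 15 : ℝ)).div (hasDerivAt_id u) hu0
    refine h1.congr_deriv ?_
    simp only [id, hφ']
    field_simp
    ring
  have hφ'c : ContinuousOn φ' (Set.uIcc (1 / 5 : ℝ) (4 / 15)) := by
    rw [huI]
    exact continuousOn_const.div (continuousOn_id.pow 2) fun u hu => by
      exact pow_ne_zero 2 (by linarith [hu.1])
  have hGcc : ContinuousOn Gc (φ '' Set.uIcc (1 / 5 : ℝ) (4 / 15)) := by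
    have hsub : φ '' Set.uIcc (1 / 5 : ℝ) (4 / 15) ⊆ Set.Ioi 0 := by
      rw [huI]
      rintro _ ⟨u, hu, rfl⟩
      simp only [Set.mem_Ioi, hφ]
      exact div_pos (by linarith [hu.2]) (by linarith [hu.1])
    refine ContinuousOn.mono ?_ hsub
    refine (continuousOn_const.mul ((continuousOn_id.sub continuousOn_const).div
      (continuousOn_id.add continuousOn_const) fun s hs => ?_)).mul h.continuousOn_upper
    simp only [Set.mem_Ioi] at hs
    show s + 1 ≠ 0
    exact ne_of_gt (by linarith)
  have hsubst := intervalIntegral.integral_comp_mul_deriv' (a := (1 / 5 : ℝ)) (b := 4 / 15)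
    (f := φ) (f' := φ') (g := Gc) hφd hφ'c hGcc
  -- identify the integrand
  have hcongr : ∀ u ∈ Set.uIcc (1 / 5 : ℝ) (4 / 15),
      (1 - 2 * u) * F ((16 / 15 - u) / u) * ((1 / 5) / u) / u = (Gc ∘ φ) u * φ' u := by
    intro u hu
    rw [huI] at hu
    have hu0 : u ≠ 0 := by linarith [hu.1]
    have hφ1 : φ u + 1 ≠ 0 := by
      simp only [hφ]
      have : 0 < (16 / 15 - u) / u := div_pos (by linarith [hu.2]) (by linarith [hu.1])
      linarith
    simp only [Function.comp, hGc, hφ, hφ']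
    simp only [hφ] at hφ1
    field_simp
    ring
  rw [intervalIntegral.integral_congr hcongr, hsubst]
  have hφa : φ (1 / 5) = 13 / 3 := by simp only [hφ]; norm_num
  have hφb : φ (4 / 15) = 3 := by simp only [hφ]; norm_num
  rw [hφa, hφb, intervalIntegral.integral_symm, Jint, ← intervalIntegral.integral_const_mul,
    ← intervalIntegral.integral_neg]
  refine intervalIntegral.integral_congr fun s _ => ?_
  simp only [hGc]
  ring

/-- `J = A (J₁ + J₂)` with `J₁ = ∫ (s − 17/15)/(s(s+1))` elementary (`= P₁(13/3) − P₁(3)`,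
`P₁(s) = −(17/15) log s + (32/15) log(s+1)`). [folklore] -/
theorem Jint_eq (h : IsLinearSieveFunctions F f) :
    Jint F = sieveA * (((-(17 / 15) * Real.log (13 / 3) + (32 / 15) * Real.log (13 / 3 + 1)) -
      (-(17 / 15) * Real.log 3 + (32 / 15) * Real.log (3 + 1))) + J2int) := by
  unfold Jint
  have hcongr : ∀ s ∈ Set.uIcc (3 : ℝ) (13 / 3), (s - 17 / 15) * F s / (s + 1) =
      sieveA * ((s - 17 / 15) / (s * (s + 1))) +
        sieveA * ((s - 17 / 15) * logInt (s - 1) / (s * (s + 1))) := by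
    intro s hs
    rw [Set.uIcc_of_le (by norm_num : (3:ℝ) ≤ 13/3)] at hs
    rw [h.upper_eq_logInt_div hs.1 (by linarith [hs.2])]
    have : s ≠ 0 := by linarith [hs.1]
    have : s + 1 ≠ 0 := by linarith [hs.1]
    field_simp
  rw [intervalIntegral.integral_congr hcongr]
  have hi1 : IntervalIntegrable (fun s : ℝ => sieveA * ((s - 17 / 15) / (s * (s + 1))))
      MeasureTheory.volume (3 : ℝ) (13 / 3) := by
    refine (ContinuousOn.intervalIntegrable_of_Icc (by norm_num) ?_)
    exact continuousOn_const.mul ((continuousOn_id.sub continuousOn_const).div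
      (continuousOn_id.mul (continuousOn_id.add continuousOn_const)) fun s hs => by
        exact mul_ne_zero (by linarith [hs.1]) (by linarith [hs.1]))
  have hi2 : IntervalIntegrable
      (fun s : ℝ => sieveA * ((s - 17 / 15) * logInt (s - 1) / (s * (s + 1))))
      MeasureTheory.volume (3 : ℝ) (13 / 3) := by
    refine (ContinuousOn.intervalIntegrable_of_Icc (by norm_num) ?_)
    refine continuousOn_const.mul ?_
    have hI : ContinuousOn (fun s : ℝ => logInt (s - 1)) (Set.Icc 3 (13 / 3)) := fun s hs =>
      (hasDerivAt_logInt_sub_one (by linarith [hs.1] : (2:ℝ) < s)).continuousAt.continuousWithinAt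
    exact ((continuousOn_id.sub continuousOn_const).mul hI).div
      (continuousOn_id.mul (continuousOn_id.add continuousOn_const)) fun s hs => by
        exact mul_ne_zero (by linarith [hs.1]) (by linarith [hs.1])
  rw [intervalIntegral.integral_add hi1 hi2, intervalIntegral.integral_const_mul,
    intervalIntegral.integral_const_mul, J2int]
  -- the elementary integral
  have hderiv : ∀ s ∈ Set.uIcc (3 : ℝ) (13 / 3),
      HasDerivAt (fun s : ℝ => -(17 / 15) * Real.log s + (32 / 15) * Real.log (s + 1))
        ((s - 17 / 15) / (s * (s + 1))) s := by
    intro s hs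
    rw [Set.uIcc_of_le (by norm_num : (3:ℝ) ≤ 13/3)] at hs
    have hs0 : s ≠ 0 := by linarith [hs.1]
    have hs1 : s + 1 ≠ 0 := by linarith [hs.1]
    have h1 := (Real.hasDerivAt_log hs0).const_mul (-(17 / 15) : ℝ)
    have h2 := (((hasDerivAt_id s).add_const (1 : ℝ)).log hs1).const_mul (32 / 15 : ℝ)
    refine (h1.add h2).congr_deriv ?_
    (try simp only [id])
    field_simp
    ring
  rw [intervalIntegral.integral_eq_sub_of_hasDerivAt hderiv (by
    refine (ContinuousOn.intervalIntegrable_of_Icc (by norm_num) ?_)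
    exact ((continuousOn_id.sub continuousOn_const).div
      (continuousOn_id.mul (continuousOn_id.add continuousOn_const)) fun s hs => by
        exact mul_ne_zero (by linarith [hs.1]) (by linarith [hs.1])))]
  ring

/-- `T3 = T3a + T3b`. [folklore] -/
theorem T3_eq (h : IsLinearSieveFunctions F f) :
    ∫ u in (1 / 5 : ℝ)..(1 / 2), (1 - 2 * u) * F ((16 / 15 - u) / u) * ((1 / 5) / u) / u =
      (3 / 16) * Jint F +
      (sieveA / 5 * ((15 / 16) * Real.log (1 / 2) + (17 / 16) * Real.log (16 / 15 - 1 / 2)) -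
        sieveA / 5 *
          ((15 / 16) * Real.log (4 / 15) + (17 / 16) * Real.log (16 / 15 - 4 / 15))) := by
  have hcont : ContinuousOn (fun u : ℝ => (1 - 2 * u) * F ((16 / 15 - u) / u) * ((1 / 5) / u) / u)
      (Set.Icc (1 / 5) (1 / 2)) := by
    have hφc : ContinuousOn (fun u : ℝ => (16 / 15 - u) / u) (Set.Icc (1 / 5) (1 / 2)) :=
      (continuousOn_const.sub continuousOn_id).div continuousOn_id fun u hu => by
        linarith [hu.1]
    have hF : ContinuousOn (fun u : ℝ => F ((16 / 15 - u) / u)) (Set.Icc (1 / 5) (1 / 2)) :=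
      h.continuousOn_upper.comp hφc fun u hu => by
        simp only [Set.mem_Ioi]; exact div_pos (by linarith [hu.2]) (by linarith [hu.1])
    refine ContinuousOn.div (ContinuousOn.mul ((continuousOn_const.sub
      (continuousOn_const.mul continuousOn_id)).mul hF)
      (continuousOn_const.div continuousOn_id fun u hu => ?_)) continuousOn_id fun u hu => ?_
    · linarith [hu.1]
    · linarith [hu.1]
  rw [← intervalIntegral.integral_add_adjacent_intervals (b := 4 / 15)
    (hcont.mono (Set.Icc_subset_Icc le_rfl (by norm_num)) |>.intervalIntegrable_of_Icc
      (by norm_num))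
    (hcont.mono (Set.Icc_subset_Icc (by norm_num) le_rfl) |>.intervalIntegrable_of_Icc
      (by norm_num)),
    T3a_eq h, T3b_eq h]

/-- `T1 = f(16/3) = (3/16) A (log(13/3) + K)` (the second display of p. 187 at `s = 16/3`).
[cite: IwaniecInventiones1978, §6 p. 187] -/
theorem T1_eq (h : IsLinearSieveFunctions F f) :
    f (16 / 3) = (3 / 16) * (sieveA * (Real.log (16 / 3 - 1) + Kint)) := by
  have h1 := h.mul_lower_eq_of_le_six (s := 16 / 3) (by norm_num) (by norm_num)
  have e : (16 / 3 : ℝ) - 1 = 13 / 3 := by norm_num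
  rw [e] at h1 ⊢
  rw [show Kint = ∫ t in (3 : ℝ)..(13 / 3), logInt (t - 1) / t from rfl]
  have h16 : (16 / 3 : ℝ) ≠ 0 := by norm_num
  field_simp at h1 ⊢
  linarith

end IsLinearSieveFunctions

/-! ### The numerical inequality -/

namespace IsLinearSieveFunctions

variable {F f : ℝ → ℝ}

/-- **`f(16/3) − T3 − T4 − T5 ≥ A · Cnum`** (exact algebra + `M ≤ Pm(13/3) − Pm(3)`).
[cite: IwaniecInventiones1978, §6 p. 187] -/
theorem W5_ge (h : IsLinearSieveFunctions F f) :
    sieveA * Cnum ≤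
      f (16 / 3)
        - (∫ u in (1 / 5 : ℝ)..(1 / 2), (1 - 2 * u) * F ((16 / 15 - u) / u) * ((1 / 5) / u) / u)
        - (∫ u in (1 / 5 : ℝ)..(1 / 2), F (5 * (16 / 15 - u)))
        - (∫ u in (1 / 2 : ℝ)..1, (1 - u) * F (5 * (16 / 15 - u)) / u) := by
  rw [T1_eq h, T3_eq h, T4_eq h, T5_eq h, Jint_eq h]
  have hkey := key_combination
  have hM := Mint_le
  have hA : 0 ≤ sieveA := by unfold sieveA; positivity
  unfold Cnum
  nlinarith [mul_le_mul_of_nonneg_left hM hA, hkey]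

/-- **The numerical inequality of §6 — PROVED:** for ANY solution of the delay-differential system,
`e^γ/770 < f(16/3) − T3 − T4 − T5`, i.e. `W₅' > γ e^γ/154` with `γ = 1/5` (p. 187 prints
`W > 2e^C γ/154` for the five-term `W ⊇ W₅'`; with the correct `V(z) ∼ 2Γe^{-γ}/log z` one half of
that suffices, and the double sum may be dropped). [cite: IwaniecInventiones1978, §6 p. 187] -/
theorem numerics (h : IsLinearSieveFunctions F f) :
    Real.exp Real.eulerMascheroniConstant / 770 <
      f (16 / 3)
        - (∫ u in (1 / 5 : ℝ)..(1 / 2), (1 - 2 * u) * F ((16 / 15 - u) / u) * ((1 / 5) / u) / u)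
        - (∫ u in (1 / 5 : ℝ)..(1 / 2), F (5 * (16 / 15 - u)))
        - (∫ u in (1 / 2 : ℝ)..1, (1 - u) * F (5 * (16 / 15 - u)) / u) := by
  have h1 := W5_ge h
  have h2 := Cnum_gt
  have hE : 0 < Real.exp Real.eulerMascheroniConstant := Real.exp_pos _
  have : Real.exp Real.eulerMascheroniConstant / 770 < sieveA * Cnum := by
    unfold sieveA
    nlinarith
  linarith

end IsLinearSieveFunctions

end Literature.NumberTheory.Sieve.Iwaniec1978

end
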